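import Literature.NumberTheory.LFunctions.WeilTwoPrimeOddMarginHBase
import Literature.NumberTheory.LFunctions.WeilTwoPrimeOddMarginHDataP22
import Literature.NumberTheory.LFunctions.WeilBlockRowsPZ
import Literature.NumberTheory.LFunctions.WeilBlockRowsFast
import HarnessLib

/-!
# Two-prime odd-margin certificate H: dominance of rows 82–82 of `R = S'_odd(κ') − UᵀU` (factored data)

`WeilCert.checkDomRowPZ` with the materialized block `weilCert23HPm`, the factored inverse `weilCert23HDn/weilCert23HLs` and the Bessel block `weilCert23HHp`, by `decide +kernel` row by row; converted to `checkDomRow` by `WeilCert.checkDomRow_of_PZ` in the assembly file. Pure proof file.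
-/

noncomputable section

namespace Literature.NumberTheory.LFunctions

set_option maxHeartbeats 0 in
/-- Kernel check of the dominance of row 82 of `R` (certificate H, factored data). [folklore] -/
theorem checkDomRowPZ1_82_weilCert23H :
    weilCert23HBase.checkDomRowPZ weilCert23HPm weilCert23HDn weilCert23HLs weilCert23HHp weilCert23HKappa' 1 82 = true :=
  WeilCert.checkDomRowPZ_of_F (by decide) (by decide +kernel : weilCert23HBase.checkDomRowF weilCert23HPm weilCert23HDn weilCert23HLs weilCert23HHp weilCert23HKappa' 1 82 = true)


end Literature.NumberTheory.LFunctions
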